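import Summits.QuantumFields.YangMills.Theorems.CurvaturePoincareBoxBonds
import HarnessLib

/-!
# LINE 30 «CurvaturePoincare» — the box Uhlenbeck lemma, torus side II: direction-`2` bonds of one root, and the three coordinate-line sums inject into the
# box plaquette sum

Crux of record `PoincareLipschitz.MesoscopicConcentrationL` (stmt-QuantumFields-23532; LINE 30 skeleton `Cruxes/HistoryTailL/Lines/curvature_poincare.lean`
sha16 e95b7bfb5ac8bc91, NP sub-plan `…/curvature_poincare_planNP.lean`, ideator ym-r3-idea-2 g16); cell `ym3-torus` (YM ladder rung R3 = continuum `SU(2)`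
Yang–Mills on T³ — a RUNG, NOT the Clay problem); width seat `ym3-torus-px19` gen 9 (NP pen of record, ★★OWNER WORD 43).  Third of four NP files:
`CurvaturePoincareAxialLadderSums` → `CurvaturePoincareBoxBonds` → THIS → `CurvaturePoincareBoxUhlenbeck`.
WHAT IS PROVED (member `F.P K`; any `[GaugeGroup G]`): §0 `sum_sq_dir_two_le` — for the root `lo + r·e₀`, the direction-`2` bonds of the `ZMod` box, squared
and summed, are `≤ 2(n−1)·(n²·S₁₂(r) + n·S₀₂)` (the `(1,2)`-line of the spine plane `x₀ = lo₀ + r` is seen by all `n²` bonds above it — this is where ONE fixed root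
costs `n²` —, each `(0,2)`-line by `n`); §1 the coordinate-line sums `S₀₁`, `Σ_{r<n} S₁₂(r)`, `S₀₂` (sums of `dist₁(U(∂p))²` over box plaquettes counted by integer
offsets) are each `≤ Σ_{p ∈ boxPlaqs} dist₁(U(∂p))²` (injections `(t,b,c) ↦ ⟨castSite(lo + …), κ, μ⟩`, `castSite_injOn_box`, plaquette dictionary
`hol_pull_plaqWord_of_lt`, `Finset.sum_image`).
HONEST SCOPE.  Bookkeeping; proves nothing of `stub_boxUhlenbeck` ∕ NP by itself (next file), nothing of LM ∕ B♯ ∕ MD, K1 (23532), 23083, 19936, 19200, 20520 or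
rung R3; R3 = continuum `SU(2)` YM on T³ — NOT d = 4, NOT infinite volume, NOT a mass gap, NOT Clay.  THEOREMS ONLY (0 `def`, 0 `sorry`);
`--supports stmt-QuantumFields-23532`.
References: M. Creutz, «Quarks, gluons and lattices» (1983) ch. 9 [folklore]; T. Bałaban, CMP 98 (1985) pp. 24–25 [Balaban1985Averaging].
-/

set_option autoImplicit false

open scoped BigOperators
open Literature.MathematicalPhysics.QuantumFieldTheory.Balaban1983to89
open Literature.MathematicalPhysics.QuantumFieldTheory.Balaban1983to89.T3ContinuumYM3Torus
open Literature.MathematicalPhysics.QuantumFieldTheory.Balaban1983to89.T4AxialGaugeSmallField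
  (boxPlaqs castSite castSite_apply pull pull_apply hol_pull_plaqWord_of_lt castSite_injOn_box)
open Literature.MathematicalPhysics.QuantumFieldTheory.Balaban1983to89.B7Prop1Explicit
  (e e_apply hol gaugeAct plaqWord axialFn)
open Summit.QuantumFields.YangMills.Theorems.CurvaturePoincareBoxBonds
  (le_ptP ptP_le ptP_add_e_zero_add_e_one_le ptP_add_e_one_add_e_two_le ptP_add_e_zero_add_e_two_le ptP_apply_zero ptP_apply_one ptP_apply_two
  bond_coords gaugeAct_castSite_of_root exists_rooted_gauge gaugeAct_zero_eq_one dist1_gaugeAct_two_le injOn_bond_coords sum_sq_dir_one_le)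

namespace Summit.QuantumFields.YangMills.Theorems.CurvaturePoincareBoxLineSums

section Member

variable (F : T3Family) (K : ℕ) {G : Type*} [GaugeGroup G]

/-! ## §0 Direction-`2` bonds of one root, squared and summed -/

/-- **DIRECTION-2 BONDS OF THE BOX, SQUARED AND SUMMED** (root `r ≤ n − 1`): `Σ_{B} dist₁((U^g)_b)² ≤ 2(n−1)·(n·n·S₁₂(r) + n·S₀₂)` — the `(1,2)`-line of the
spine plane `x₀ = lo₀ + r` is seen by all `n²` bonds above it (this is where ONE fixed root costs `n²`), each `(0,2)`-line by `n`. [folklore] -/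
theorem sum_sq_dir_two_le (U : GaugeField (F.P K) 0 G) {n : ℕ} (hn : 1 ≤ n) (h2n : 2 * n ≤ (F.P K).sitesPerDir 0) (x₀ : Site (F.P K) 0)
    {r : ℕ} (hr : r ≤ n - 1) (g : GaugeTransf (F.P K) 0 G)
    (hg : ∀ x, (fun k => ((x₀ k).val : ℤ)) ≤ x → x ≤ (fun k => ((x₀ k).val : ℤ) + ((n - 1 : ℕ) : ℤ)) →
      g (castSite x) = axialFn (pull U) ((fun k => ((x₀ k).val : ℤ)) + (r : ℤ) • e 0) x)
    (B : Finset (PBond (F.P K) 0))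
    (hB : ∀ b ∈ B, (∀ k, (b.src k - x₀ k).val < n) ∧ (∀ k, (b.tgt k - x₀ k).val < n) ∧ b.dir = 2) :
    ∑ b ∈ B, dist1 (GaugeField.gaugeAct g U b) ^ 2 ≤
      2 * ((n - 1 : ℕ) : ℝ) * ((n : ℝ) * (n : ℝ) * ∑ v₂ ∈ Finset.range (n - 1), ∑ s ∈ Finset.range (n - 1),
          dist1 (hol (pull U) ((fun k => ((x₀ k).val : ℤ)) + (r : ℤ) • e 0 + (s : ℤ) • e 1 + (v₂ : ℤ) • e 2) (plaqWord 1 2)) ^ 2 +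
        (n : ℝ) * ∑ v₁ ∈ Finset.range n, ∑ v₂ ∈ Finset.range (n - 1), ∑ t ∈ Finset.range (n - 1),
          dist1 (hol (pull U) ((fun k => ((x₀ k).val : ℤ)) + (t : ℤ) • e 0 + (v₁ : ℤ) • e 1 + (v₂ : ℤ) • e 2) (plaqWord 0 2)) ^ 2) := by
  classical
  set lo : Fin (F.P K).d → ℤ := fun k => ((x₀ k).val : ℤ) with hlo
  set N := n - 1 with hN
  have key : ∀ b ∈ B, dist1 (GaugeField.gaugeAct g U b) ^ 2 ≤
      2 * (N : ℝ) * ((∑ s ∈ Finset.range N, dist1 (hol (pull U) (lo + (r : ℤ) • e 0 + (s : ℤ) • e 1 +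
          (((b.src 2 - x₀ 2).val : ℕ) : ℤ) • e 2) (plaqWord 1 2)) ^ 2) +
        ∑ t ∈ Finset.range N, dist1 (hol (pull U) (lo + (t : ℤ) • e 0 + (((b.src 1 - x₀ 1).val : ℕ) : ℤ) • e 1 +
          (((b.src 2 - x₀ 2).val : ℕ) : ℤ) • e 2) (plaqWord 0 2)) ^ 2) := by
    intro b hb
    obtain ⟨hs, ht, hdir⟩ := hB b hb
    obtain ⟨hv, hvd, hsrc⟩ := bond_coords F K hn h2n x₀ b hs ht
    rw [hdir] at hvd
    have hb_eq : b = ⟨castSite (lo + (((b.src 0 - x₀ 0).val : ℕ) : ℤ) • e 0 + (((b.src 1 - x₀ 1).val : ℕ) : ℤ) • e 1 +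
        (((b.src 2 - x₀ 2).val : ℕ) : ℤ) • e 2), 2⟩ := by
      obtain ⟨src, dir⟩ := b
      simp only at hdir hsrc
      subst hdir
      exact congrArg (fun s => (⟨s, 2⟩ : PBond (F.P K) 0)) hsrc
    have h1 := dist1_gaugeAct_two_le F K U lo hr g hg (hv 0) (hv 1) hvd
    rw [← hb_eq] at h1
    set A := ∑ s ∈ Finset.range N, dist1 (hol (pull U) (lo + (r : ℤ) • e 0 + (s : ℤ) • e 1 +
      (((b.src 2 - x₀ 2).val : ℕ) : ℤ) • e 2) (plaqWord 1 2)) with hA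
    set A2 := ∑ s ∈ Finset.range N, dist1 (hol (pull U) (lo + (r : ℤ) • e 0 + (s : ℤ) • e 1 +
      (((b.src 2 - x₀ 2).val : ℕ) : ℤ) • e 2) (plaqWord 1 2)) ^ 2 with hA2
    set Bs := ∑ t ∈ Finset.range N, dist1 (hol (pull U) (lo + (t : ℤ) • e 0 + (((b.src 1 - x₀ 1).val : ℕ) : ℤ) • e 1 +
      (((b.src 2 - x₀ 2).val : ℕ) : ℤ) • e 2) (plaqWord 0 2)) with hBs
    set B2 := ∑ t ∈ Finset.range N, dist1 (hol (pull U) (lo + (t : ℤ) • e 0 + (((b.src 1 - x₀ 1).val : ℕ) : ℤ) • e 1 +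
      (((b.src 2 - x₀ 2).val : ℕ) : ℤ) • e 2) (plaqWord 0 2)) ^ 2 with hB2
    have hAcs : A ^ 2 ≤ (N : ℝ) * A2 := by
      have h := sq_sum_le_card_mul_sum_sq (s := Finset.range N) (f := fun s : ℕ => dist1 (hol (pull U) (lo + (r : ℤ) • e 0 + (s : ℤ) • e 1 +
        (((b.src 2 - x₀ 2).val : ℕ) : ℤ) • e 2) (plaqWord 1 2)))
      rwa [Finset.card_range] at h
    have hBcs : Bs ^ 2 ≤ (N : ℝ) * B2 := by
      have h := sq_sum_le_card_mul_sum_sq (s := Finset.range N) (f := fun t : ℕ => dist1 (hol (pull U) (lo + (t : ℤ) • e 0 +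
        (((b.src 1 - x₀ 1).val : ℕ) : ℤ) • e 1 + (((b.src 2 - x₀ 2).val : ℕ) : ℤ) • e 2) (plaqWord 0 2)))
      rwa [Finset.card_range] at h
    have h0 : 0 ≤ dist1 (GaugeField.gaugeAct g U b) := GaugeGroup.dist1_nonneg _
    clear_value A A2 Bs B2
    calc dist1 (GaugeField.gaugeAct g U b) ^ 2 ≤ (A + Bs) ^ 2 := pow_le_pow_left₀ h0 h1 2
      _ ≤ 2 * A ^ 2 + 2 * Bs ^ 2 := by nlinarith [sq_nonneg (A - Bs)]
      _ ≤ 2 * ((N : ℝ) * A2) + 2 * ((N : ℝ) * B2) := by linarith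
      _ = 2 * (N : ℝ) * (A2 + B2) := by ring
  have hmaps : ∀ b ∈ B, ((b.src 0 - x₀ 0).val, (b.src 1 - x₀ 1).val, (b.src 2 - x₀ 2).val) ∈
      Finset.range n ×ˢ (Finset.range n ×ˢ Finset.range N) := by
    intro b hb
    obtain ⟨hs, ht, hdir⟩ := hB b hb
    obtain ⟨-, hvd, -⟩ := bond_coords F K hn h2n x₀ b hs ht
    rw [hdir] at hvd
    simp only [Finset.mem_product, Finset.mem_range]
    exact ⟨hs 0, hs 1, by omega⟩
  have hinj := injOn_bond_coords F K x₀ B fun b hb => (hB b hb).2.2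
  calc ∑ b ∈ B, dist1 (GaugeField.gaugeAct g U b) ^ 2
      ≤ ∑ b ∈ B, 2 * (N : ℝ) * ((∑ s ∈ Finset.range N, dist1 (hol (pull U) (lo + (r : ℤ) • e 0 + (s : ℤ) • e 1 +
          (((b.src 2 - x₀ 2).val : ℕ) : ℤ) • e 2) (plaqWord 1 2)) ^ 2) +
        ∑ t ∈ Finset.range N, dist1 (hol (pull U) (lo + (t : ℤ) • e 0 + (((b.src 1 - x₀ 1).val : ℕ) : ℤ) • e 1 +
          (((b.src 2 - x₀ 2).val : ℕ) : ℤ) • e 2) (plaqWord 0 2)) ^ 2) := Finset.sum_le_sum key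
    _ = ∑ v ∈ B.image (fun b : PBond (F.P K) 0 => ((b.src 0 - x₀ 0).val, (b.src 1 - x₀ 1).val, (b.src 2 - x₀ 2).val)), 2 * (N : ℝ) *
          ((∑ s ∈ Finset.range N, dist1 (hol (pull U) (lo + (r : ℤ) • e 0 + (s : ℤ) • e 1 + (v.2.2 : ℤ) • e 2) (plaqWord 1 2)) ^ 2) +
            ∑ t ∈ Finset.range N, dist1 (hol (pull U) (lo + (t : ℤ) • e 0 + (v.2.1 : ℤ) • e 1 + (v.2.2 : ℤ) • e 2) (plaqWord 0 2)) ^ 2) :=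
        (Finset.sum_image (f := fun v : ℕ × ℕ × ℕ => 2 * (N : ℝ) *
          ((∑ s ∈ Finset.range N, dist1 (hol (pull U) (lo + (r : ℤ) • e 0 + (s : ℤ) • e 1 + (v.2.2 : ℤ) • e 2) (plaqWord 1 2)) ^ 2) +
            ∑ t ∈ Finset.range N, dist1 (hol (pull U) (lo + (t : ℤ) • e 0 + (v.2.1 : ℤ) • e 1 + (v.2.2 : ℤ) • e 2) (plaqWord 0 2)) ^ 2))
          fun x hx y hy h => hinj hx hy h).symm
    _ ≤ ∑ v ∈ Finset.range n ×ˢ (Finset.range n ×ˢ Finset.range N), 2 * (N : ℝ) *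
          ((∑ s ∈ Finset.range N, dist1 (hol (pull U) (lo + (r : ℤ) • e 0 + (s : ℤ) • e 1 + (v.2.2 : ℤ) • e 2) (plaqWord 1 2)) ^ 2) +
            ∑ t ∈ Finset.range N, dist1 (hol (pull U) (lo + (t : ℤ) • e 0 + (v.2.1 : ℤ) • e 1 + (v.2.2 : ℤ) • e 2) (plaqWord 0 2)) ^ 2) :=
        Finset.sum_le_sum_of_subset_of_nonneg
          (fun v hv => by obtain ⟨b, hb, rfl⟩ := Finset.mem_image.1 hv; exact hmaps b hb)
          fun v _ _ => mul_nonneg (mul_nonneg (by norm_num) (Nat.cast_nonneg _))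
            (add_nonneg (Finset.sum_nonneg fun _ _ => sq_nonneg _) (Finset.sum_nonneg fun _ _ => sq_nonneg _))
    _ = 2 * (N : ℝ) * ((n : ℝ) * (n : ℝ) * ∑ v₂ ∈ Finset.range N, ∑ s ∈ Finset.range N,
          dist1 (hol (pull U) (lo + (r : ℤ) • e 0 + (s : ℤ) • e 1 + (v₂ : ℤ) • e 2) (plaqWord 1 2)) ^ 2 +
        (n : ℝ) * ∑ v₁ ∈ Finset.range n, ∑ v₂ ∈ Finset.range N, ∑ t ∈ Finset.range N,
          dist1 (hol (pull U) (lo + (t : ℤ) • e 0 + (v₁ : ℤ) • e 1 + (v₂ : ℤ) • e 2) (plaqWord 0 2)) ^ 2) := by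
        rw [Finset.sum_product]
        dsimp only
        rw [Finset.sum_const, Finset.card_range, nsmul_eq_mul, Finset.sum_product]
        dsimp only
        simp only [mul_add, Finset.sum_add_distrib, Finset.sum_const, Finset.card_range, nsmul_eq_mul, ← Finset.mul_sum]
        ring

/-! ## §1 The three coordinate-line sums inject into the box plaquette sum -/

/-- The `(0,1)`-plaquettes of the box, counted by integer offsets `(t, b, c)` (`t, b < n − 1`, `c < n`), inject into `boxPlaqs`:
`S₀₁ ≤ Σ_{p ∈ boxPlaqs} dist₁(U(∂p))²` (`castSite_injOn_box` + the plaquette dictionary `hol_pull_plaqWord_of_lt`). [folklore] -/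
theorem lineSum01_le_boxSum (U : GaugeField (F.P K) 0 G) {n : ℕ} (hn : 1 ≤ n) (h2n : 2 * n ≤ (F.P K).sitesPerDir 0) (x₀ : Site (F.P K) 0) :
    open Classical in
    ∑ v₁ ∈ Finset.range (n - 1), ∑ v₂ ∈ Finset.range n, ∑ t ∈ Finset.range (n - 1),
        dist1 (hol (pull U) ((fun k => ((x₀ k).val : ℤ)) + (t : ℤ) • e 0 + (v₁ : ℤ) • e 1 + (v₂ : ℤ) • e 2) (plaqWord 0 1)) ^ 2 ≤
      ∑ p ∈ Finset.univ.filter (fun p : Plaq (F.P K) 0 => p ∈ boxPlaqs (P := F.P K) (j := 0) (fun k => ((x₀ k).val : ℤ))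
        (fun k => ((x₀ k).val : ℤ) + ((n : ℤ) - 1))), dist1 (GaugeField.plaqHol U p) ^ 2 := by
  classical
  set lo : Fin (F.P K).d → ℤ := fun k => ((x₀ k).val : ℤ) with hlo
  set N := n - 1 with hN
  have hhi : (fun k => ((x₀ k).val : ℤ) + ((n : ℤ) - 1)) = fun k => lo k + (N : ℤ) := by
    funext k
    show ((x₀ k).val : ℤ) + ((n : ℤ) - 1) = ((x₀ k).val : ℤ) + ((n - 1 : ℕ) : ℤ)
    omega
  have hNn : ∀ κ, (fun k => lo k + (N : ℤ)) κ - lo κ < (F.P K).sitesPerDir 0 := fun κ => by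
    show lo κ + (N : ℤ) - lo κ < ((F.P K).sitesPerDir 0 : ℤ)
    omega
  have h01 : (0 : Fin (F.P K).d) < 1 := show (0 : Fin 3) < 1 by decide
  rw [hhi]
  have hinj : Set.InjOn (fun q : ℕ × ℕ × ℕ =>
      (⟨castSite (lo + (q.2.2 : ℤ) • e 0 + (q.1 : ℤ) • e 1 + (q.2.1 : ℤ) • e 2), 0, 1, h01⟩ : Plaq (F.P K) 0))
      ↑(Finset.range N ×ˢ (Finset.range n ×ˢ Finset.range N)) := by
    intro q hq q' hq' h
    simp only [Finset.coe_product, Finset.coe_range, Set.mem_prod, Set.mem_Iio] at hq hq'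
    have hsrc : (castSite (lo + (q.2.2 : ℤ) • e 0 + (q.1 : ℤ) • e 1 + (q.2.1 : ℤ) • e 2) : Site (F.P K) 0) =
        castSite (lo + (q'.2.2 : ℤ) • e 0 + (q'.1 : ℤ) • e 1 + (q'.2.1 : ℤ) • e 2) := congrArg Plaq.src h
    have hz := castSite_injOn_box hNn (le_ptP F K lo _ _ _) (ptP_le F K lo (by omega) (by omega) (by omega))
      (le_ptP F K lo _ _ _) (ptP_le F K lo (by omega) (by omega) (by omega)) hsrc
    have e0 := congr_fun hz 0
    have e1 := congr_fun hz 1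
    have e2 := congr_fun hz 2
    rw [ptP_apply_zero, ptP_apply_zero] at e0
    rw [ptP_apply_one, ptP_apply_one] at e1
    rw [ptP_apply_two, ptP_apply_two] at e2
    exact Prod.ext (by omega) (Prod.ext (by omega) (by omega))
  calc ∑ v₁ ∈ Finset.range N, ∑ v₂ ∈ Finset.range n, ∑ t ∈ Finset.range N,
          dist1 (hol (pull U) (lo + (t : ℤ) • e 0 + (v₁ : ℤ) • e 1 + (v₂ : ℤ) • e 2) (plaqWord 0 1)) ^ 2
      = ∑ q ∈ Finset.range N ×ˢ (Finset.range n ×ˢ Finset.range N),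
          dist1 (GaugeField.plaqHol U ⟨castSite (lo + (q.2.2 : ℤ) • e 0 + (q.1 : ℤ) • e 1 + (q.2.1 : ℤ) • e 2), 0, 1, h01⟩) ^ 2 := by
        rw [Finset.sum_product]
        refine Finset.sum_congr rfl fun v₁ _ => ?_
        rw [Finset.sum_product]
        refine Finset.sum_congr rfl fun v₂ _ => Finset.sum_congr rfl fun t _ => ?_
        rw [hol_pull_plaqWord_of_lt U _ h01]
    _ = ∑ p ∈ (Finset.range N ×ˢ (Finset.range n ×ˢ Finset.range N)).image (fun q : ℕ × ℕ × ℕ =>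
          (⟨castSite (lo + (q.2.2 : ℤ) • e 0 + (q.1 : ℤ) • e 1 + (q.2.1 : ℤ) • e 2), 0, 1, h01⟩ : Plaq (F.P K) 0)),
          dist1 (GaugeField.plaqHol U p) ^ 2 :=
        (Finset.sum_image (f := fun p : Plaq (F.P K) 0 => dist1 (GaugeField.plaqHol U p) ^ 2) hinj).symm
    _ ≤ _ := by
        refine Finset.sum_le_sum_of_subset_of_nonneg (fun p hp => ?_) fun _ _ _ => sq_nonneg _
        obtain ⟨q, hq, rfl⟩ := Finset.mem_image.1 hp
        simp only [Finset.mem_product, Finset.mem_range] at hq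
        exact Finset.mem_filter.2 ⟨Finset.mem_univ _, _, le_ptP F K lo _ _ _,
          ptP_add_e_zero_add_e_one_le F K lo (by omega) (by omega) (by omega), rfl⟩

/-- The `(1,2)`-plaquettes of the box, counted by `(a, s, c)` (`a < n`, `s, c < n − 1`) — the spine-plane lines of ALL roots together — inject into `boxPlaqs`:
`Σ_r S₁₂(r) ≤ Σ_{p ∈ boxPlaqs} dist₁(U(∂p))²`. [folklore] -/
theorem lineSum12_le_boxSum (U : GaugeField (F.P K) 0 G) {n : ℕ} (hn : 1 ≤ n) (h2n : 2 * n ≤ (F.P K).sitesPerDir 0) (x₀ : Site (F.P K) 0) :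
    open Classical in
    ∑ a ∈ Finset.range n, ∑ c ∈ Finset.range (n - 1), ∑ s ∈ Finset.range (n - 1),
        dist1 (hol (pull U) ((fun k => ((x₀ k).val : ℤ)) + (a : ℤ) • e 0 + (s : ℤ) • e 1 + (c : ℤ) • e 2) (plaqWord 1 2)) ^ 2 ≤
      ∑ p ∈ Finset.univ.filter (fun p : Plaq (F.P K) 0 => p ∈ boxPlaqs (P := F.P K) (j := 0) (fun k => ((x₀ k).val : ℤ))
        (fun k => ((x₀ k).val : ℤ) + ((n : ℤ) - 1))), dist1 (GaugeField.plaqHol U p) ^ 2 := by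
  classical
  set lo : Fin (F.P K).d → ℤ := fun k => ((x₀ k).val : ℤ) with hlo
  set N := n - 1 with hN
  have hhi : (fun k => ((x₀ k).val : ℤ) + ((n : ℤ) - 1)) = fun k => lo k + (N : ℤ) := by
    funext k
    show ((x₀ k).val : ℤ) + ((n : ℤ) - 1) = ((x₀ k).val : ℤ) + ((n - 1 : ℕ) : ℤ)
    omega
  have hNn : ∀ κ, (fun k => lo k + (N : ℤ)) κ - lo κ < (F.P K).sitesPerDir 0 := fun κ => by
    show lo κ + (N : ℤ) - lo κ < ((F.P K).sitesPerDir 0 : ℤ)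
    omega
  have h12 : (1 : Fin (F.P K).d) < 2 := show (1 : Fin 3) < 2 by decide
  rw [hhi]
  have hinj : Set.InjOn (fun q : ℕ × ℕ × ℕ =>
      (⟨castSite (lo + (q.1 : ℤ) • e 0 + (q.2.2 : ℤ) • e 1 + (q.2.1 : ℤ) • e 2), 1, 2, h12⟩ : Plaq (F.P K) 0))
      ↑(Finset.range n ×ˢ (Finset.range N ×ˢ Finset.range N)) := by
    intro q hq q' hq' h
    simp only [Finset.coe_product, Finset.coe_range, Set.mem_prod, Set.mem_Iio] at hq hq'
    have hsrc : (castSite (lo + (q.1 : ℤ) • e 0 + (q.2.2 : ℤ) • e 1 + (q.2.1 : ℤ) • e 2) : Site (F.P K) 0) =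
        castSite (lo + (q'.1 : ℤ) • e 0 + (q'.2.2 : ℤ) • e 1 + (q'.2.1 : ℤ) • e 2) := congrArg Plaq.src h
    have hz := castSite_injOn_box hNn (le_ptP F K lo _ _ _) (ptP_le F K lo (by omega) (by omega) (by omega))
      (le_ptP F K lo _ _ _) (ptP_le F K lo (by omega) (by omega) (by omega)) hsrc
    have e0 := congr_fun hz 0
    have e1 := congr_fun hz 1
    have e2 := congr_fun hz 2
    rw [ptP_apply_zero, ptP_apply_zero] at e0
    rw [ptP_apply_one, ptP_apply_one] at e1
    rw [ptP_apply_two, ptP_apply_two] at e2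
    exact Prod.ext (by omega) (Prod.ext (by omega) (by omega))
  calc ∑ a ∈ Finset.range n, ∑ c ∈ Finset.range N, ∑ s ∈ Finset.range N,
          dist1 (hol (pull U) (lo + (a : ℤ) • e 0 + (s : ℤ) • e 1 + (c : ℤ) • e 2) (plaqWord 1 2)) ^ 2
      = ∑ q ∈ Finset.range n ×ˢ (Finset.range N ×ˢ Finset.range N),
          dist1 (GaugeField.plaqHol U ⟨castSite (lo + (q.1 : ℤ) • e 0 + (q.2.2 : ℤ) • e 1 + (q.2.1 : ℤ) • e 2), 1, 2, h12⟩) ^ 2 := by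
        rw [Finset.sum_product]
        refine Finset.sum_congr rfl fun a _ => ?_
        rw [Finset.sum_product]
        refine Finset.sum_congr rfl fun c _ => Finset.sum_congr rfl fun s _ => ?_
        rw [hol_pull_plaqWord_of_lt U _ h12]
    _ = ∑ p ∈ (Finset.range n ×ˢ (Finset.range N ×ˢ Finset.range N)).image (fun q : ℕ × ℕ × ℕ =>
          (⟨castSite (lo + (q.1 : ℤ) • e 0 + (q.2.2 : ℤ) • e 1 + (q.2.1 : ℤ) • e 2), 1, 2, h12⟩ : Plaq (F.P K) 0)),
          dist1 (GaugeField.plaqHol U p) ^ 2 :=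
        (Finset.sum_image (f := fun p : Plaq (F.P K) 0 => dist1 (GaugeField.plaqHol U p) ^ 2) hinj).symm
    _ ≤ _ := by
        refine Finset.sum_le_sum_of_subset_of_nonneg (fun p hp => ?_) fun _ _ _ => sq_nonneg _
        obtain ⟨q, hq, rfl⟩ := Finset.mem_image.1 hp
        simp only [Finset.mem_product, Finset.mem_range] at hq
        exact Finset.mem_filter.2 ⟨Finset.mem_univ _, _, le_ptP F K lo _ _ _,
          ptP_add_e_one_add_e_two_le F K lo (by omega) (by omega) (by omega), rfl⟩

/-- The `(0,2)`-plaquettes of the box, counted by `(t, b, c)` (`t, c < n − 1`, `b < n`), inject into `boxPlaqs`: `S₀₂ ≤ Σ_{p ∈ boxPlaqs} dist₁(U(∂p))²`.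
[folklore] -/
theorem lineSum02_le_boxSum (U : GaugeField (F.P K) 0 G) {n : ℕ} (hn : 1 ≤ n) (h2n : 2 * n ≤ (F.P K).sitesPerDir 0) (x₀ : Site (F.P K) 0) :
    open Classical in
    ∑ v₁ ∈ Finset.range n, ∑ v₂ ∈ Finset.range (n - 1), ∑ t ∈ Finset.range (n - 1),
        dist1 (hol (pull U) ((fun k => ((x₀ k).val : ℤ)) + (t : ℤ) • e 0 + (v₁ : ℤ) • e 1 + (v₂ : ℤ) • e 2) (plaqWord 0 2)) ^ 2 ≤
      ∑ p ∈ Finset.univ.filter (fun p : Plaq (F.P K) 0 => p ∈ boxPlaqs (P := F.P K) (j := 0) (fun k => ((x₀ k).val : ℤ))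
        (fun k => ((x₀ k).val : ℤ) + ((n : ℤ) - 1))), dist1 (GaugeField.plaqHol U p) ^ 2 := by
  classical
  set lo : Fin (F.P K).d → ℤ := fun k => ((x₀ k).val : ℤ) with hlo
  set N := n - 1 with hN
  have hhi : (fun k => ((x₀ k).val : ℤ) + ((n : ℤ) - 1)) = fun k => lo k + (N : ℤ) := by
    funext k
    show ((x₀ k).val : ℤ) + ((n : ℤ) - 1) = ((x₀ k).val : ℤ) + ((n - 1 : ℕ) : ℤ)
    omega
  have hNn : ∀ κ, (fun k => lo k + (N : ℤ)) κ - lo κ < (F.P K).sitesPerDir 0 := fun κ => by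
    show lo κ + (N : ℤ) - lo κ < ((F.P K).sitesPerDir 0 : ℤ)
    omega
  have h02 : (0 : Fin (F.P K).d) < 2 := show (0 : Fin 3) < 2 by decide
  rw [hhi]
  have hinj : Set.InjOn (fun q : ℕ × ℕ × ℕ =>
      (⟨castSite (lo + (q.2.2 : ℤ) • e 0 + (q.1 : ℤ) • e 1 + (q.2.1 : ℤ) • e 2), 0, 2, h02⟩ : Plaq (F.P K) 0))
      ↑(Finset.range n ×ˢ (Finset.range N ×ˢ Finset.range N)) := by
    intro q hq q' hq' h
    simp only [Finset.coe_product, Finset.coe_range, Set.mem_prod, Set.mem_Iio] at hq hq'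
    have hsrc : (castSite (lo + (q.2.2 : ℤ) • e 0 + (q.1 : ℤ) • e 1 + (q.2.1 : ℤ) • e 2) : Site (F.P K) 0) =
        castSite (lo + (q'.2.2 : ℤ) • e 0 + (q'.1 : ℤ) • e 1 + (q'.2.1 : ℤ) • e 2) := congrArg Plaq.src h
    have hz := castSite_injOn_box hNn (le_ptP F K lo _ _ _) (ptP_le F K lo (by omega) (by omega) (by omega))
      (le_ptP F K lo _ _ _) (ptP_le F K lo (by omega) (by omega) (by omega)) hsrc
    have e0 := congr_fun hz 0
    have e1 := congr_fun hz 1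
    have e2 := congr_fun hz 2
    rw [ptP_apply_zero, ptP_apply_zero] at e0
    rw [ptP_apply_one, ptP_apply_one] at e1
    rw [ptP_apply_two, ptP_apply_two] at e2
    exact Prod.ext (by omega) (Prod.ext (by omega) (by omega))
  calc ∑ v₁ ∈ Finset.range n, ∑ v₂ ∈ Finset.range N, ∑ t ∈ Finset.range N,
          dist1 (hol (pull U) (lo + (t : ℤ) • e 0 + (v₁ : ℤ) • e 1 + (v₂ : ℤ) • e 2) (plaqWord 0 2)) ^ 2
      = ∑ q ∈ Finset.range n ×ˢ (Finset.range N ×ˢ Finset.range N),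
          dist1 (GaugeField.plaqHol U ⟨castSite (lo + (q.2.2 : ℤ) • e 0 + (q.1 : ℤ) • e 1 + (q.2.1 : ℤ) • e 2), 0, 2, h02⟩) ^ 2 := by
        rw [Finset.sum_product]
        refine Finset.sum_congr rfl fun v₁ _ => ?_
        rw [Finset.sum_product]
        refine Finset.sum_congr rfl fun v₂ _ => Finset.sum_congr rfl fun t _ => ?_
        rw [hol_pull_plaqWord_of_lt U _ h02]
    _ = ∑ p ∈ (Finset.range n ×ˢ (Finset.range N ×ˢ Finset.range N)).image (fun q : ℕ × ℕ × ℕ =>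
          (⟨castSite (lo + (q.2.2 : ℤ) • e 0 + (q.1 : ℤ) • e 1 + (q.2.1 : ℤ) • e 2), 0, 2, h02⟩ : Plaq (F.P K) 0)),
          dist1 (GaugeField.plaqHol U p) ^ 2 :=
        (Finset.sum_image (f := fun p : Plaq (F.P K) 0 => dist1 (GaugeField.plaqHol U p) ^ 2) hinj).symm
    _ ≤ _ := by
        refine Finset.sum_le_sum_of_subset_of_nonneg (fun p hp => ?_) fun _ _ _ => sq_nonneg _
        obtain ⟨q, hq, rfl⟩ := Finset.mem_image.1 hp
        simp only [Finset.mem_product, Finset.mem_range] at hq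
        exact Finset.mem_filter.2 ⟨Finset.mem_univ _, _, le_ptP F K lo _ _ _,
          ptP_add_e_zero_add_e_two_le F K lo (by omega) (by omega) (by omega), rfl⟩

end Member

end Summit.QuantumFields.YangMills.Theorems.CurvaturePoincareBoxLineSums
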